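import Mathlib
import Summits.MatrixMultiplication.MatrixMultiplication.Theorems.SnSubsetDichotomyHyperoctahedralThresholdRotationIdentity

/-!
# Rotation re-indexing of the slide count, and slides of cyclically reduced words ≤ √(TS·TS)
# (crux `SnSubsetDichotomy.HyperoctahedralThreshold`, stmt-MatrixMultiplication-10883, refutation line
# `refutation_local_symmetry`, open core `stub_poorRigidCore`; siege k22, variation "twins ℓ² argument")

Vocabulary of the line: `μ b` involutions of `Fin n`, `x · z := z.foldl (fun v b => μ b v) x`, cyclically reduced words
`List.IsChain (· ≠ ·) (z ++ z)`, rotations `z.rotate t` (`z^{(t)}` of the crux NOTES).  The cross-conflicts of the twin route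
are governed by `Ξ = Σ_z Σ_{s ≠ t} |Fix z^{(s)} ∩ Fix z^{(t)}|` (crux NOTES §4, §11; `stub_slideBound` p108343 consumes exactly
such a sum).  This file reduces that double sum to the one-offset slide counts and then to two-sided collisions:

* `rotPair_reindex` — `Σ_z |Fix z^{(s)} ∩ Fix z^{(s+d)}| = Σ_z |Fix z ∩ Fix z^{(d)}|` over the cyclically reduced words of
  length `m` (`z ↦ z.rotate s` permutes them; `Rotation.rotate_mem_cycWords`, p111510);
* `rotSlides_le_slides` — `Σ_z |Fix z ∩ Fix z^{(d)}| ≤ #slides(red_d, red_{m-d})`, the slide set of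
  `SlidesTwoSided.slides_sq_le_twoSided` (p114584) with `A, B` the reduced words of lengths `d`, `m - d`
  (`(z, x) ↦ (x, z.take d, z.drop d)`; `z = g ++ h`, `z^{(d)} = h ++ g`);
* consequently (one line, once the module of p114584 is built on the farm — it is not importable at check time):
  `(Σ_z |Fix z ∩ Fix z^{(d)}|)² ≤ TS(red_d) · TS(red_{m-d})` by `Nat.pow_le_pow_left (rotSlides_le_slides μ hd) 2` and
  `SlidesTwoSided.slides_sq_le_twoSided μ hμ _ _`: the offset-`d` slide mass of the cyclically reduced words of length `m` is
  controlled by the two-sided collision counts at lengths `d` and `m - d` (crux NOTES §12.1 end to end).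
Pure finite combinatorics, no definitions; no hypothesis on `μ` at all (rotation and splitting are word-level).
-/

-- the problem path `MatrixMultiplication/MatrixMultiplication` (single-conjunct summit) duplicates a namespace segment
set_option linter.dupNamespace false

namespace Summit.MatrixMultiplication.MatrixMultiplication.Theorems.HyperoctahedralThreshold.SlidesRotation

open Finset
open Summit.MatrixMultiplication.MatrixMultiplication.Theorems.HyperoctahedralThreshold.Rotation

variable {n : ℕ}

/-- **Rotation re-indexing.**  Over the cyclically reduced words `z` of length `m`, the number of points fixed by both
`z^{(s)}` and `z^{(s+d)}` equals the number fixed by both `z` and `z^{(d)}` (`s ≤ m`): re-index by `z ↦ z.rotate s`. -/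
theorem rotPair_reindex (μ : Fin 3 → Equiv.Perm (Fin n)) {m s : ℕ} (hs : s ≤ m) (d : ℕ) :
    ∑ z ∈ ((Finset.univ : Finset (List.Vector (Fin 3) m)).image (fun v => v.toList)).filter
        (fun z => List.IsChain (· ≠ ·) (z ++ z)),
      ((Finset.univ : Finset (Fin n)).filter (fun x =>
        (z.rotate s).foldl (fun v c => μ c v) x = x ∧ (z.rotate (s + d)).foldl (fun v c => μ c v) x = x)).card =
    ∑ z ∈ ((Finset.univ : Finset (List.Vector (Fin 3) m)).image (fun v => v.toList)).filter
        (fun z => List.IsChain (· ≠ ·) (z ++ z)),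
      ((Finset.univ : Finset (Fin n)).filter (fun x =>
        z.foldl (fun v c => μ c v) x = x ∧ (z.rotate d).foldl (fun v c => μ c v) x = x)).card := by
  refine Finset.sum_nbij' (fun z => z.rotate s) (fun z => z.rotate (m - s)) ?_ ?_ ?_ ?_ ?_
  · intro z hz; exact rotate_mem_cycWords hz s
  · intro z hz; exact rotate_mem_cycWords hz (m - s)
  · intro z hz
    have hl : z.length = m := (mem_cycWords.1 hz).1
    show (z.rotate s).rotate (m - s) = z
    rw [List.rotate_rotate, Nat.add_sub_cancel' hs, ← hl, List.rotate_length]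
  · intro z hz
    have hl : z.length = m := (mem_cycWords.1 hz).1
    show (z.rotate (m - s)).rotate s = z
    rw [List.rotate_rotate, Nat.sub_add_cancel hs, ← hl, List.rotate_length]
  · intro z _
    simp only [List.rotate_rotate]

/-- **Slides of cyclically reduced words are slides.**  For `d ≤ m`, the based closed walks `(z, x)` (`z` cyclically
reduced of length `m`) with `x` also fixed by `z^{(d)}` inject, by `(z, x) ↦ (x, z.take d, z.drop d)`, into the slide set
of `SlidesTwoSided` for the reduced words of lengths `d` and `m - d`. -/
theorem rotSlides_le_slides (μ : Fin 3 → Equiv.Perm (Fin n)) {m d : ℕ} (hd : d ≤ m) :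
    ∑ z ∈ ((Finset.univ : Finset (List.Vector (Fin 3) m)).image (fun v => v.toList)).filter
        (fun z => List.IsChain (· ≠ ·) (z ++ z)),
      ((Finset.univ : Finset (Fin n)).filter (fun x =>
        z.foldl (fun v c => μ c v) x = x ∧ (z.rotate d).foldl (fun v c => μ c v) x = x)).card ≤
    (((Finset.univ : Finset (Fin n)) ×ˢ
      ((((Finset.univ : Finset (List.Vector (Fin 3) d)).image (fun v => v.toList)).filter
          (fun g => List.IsChain (· ≠ ·) g)) ×ˢ
       (((Finset.univ : Finset (List.Vector (Fin 3) (m - d))).image (fun v => v.toList)).filter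
          (fun g => List.IsChain (· ≠ ·) g)))).filter (fun q =>
        (q.2.1 ++ q.2.2).foldl (fun v b => μ b v) q.1 = q.1 ∧
        (q.2.2 ++ q.2.1).foldl (fun v b => μ b v) q.1 = q.1)).card := by
  rw [← Finset.card_sigma]
  refine Finset.card_le_card_of_injOn (fun zx => (zx.2, zx.1.take d, zx.1.drop d)) ?_ ?_
  · intro zx hzx
    rw [Finset.mem_coe, Finset.mem_sigma] at hzx
    obtain ⟨hz, hx⟩ := hzx
    obtain ⟨hl, hc⟩ := mem_cycWords.1 hz
    obtain ⟨-, hx1, hx2⟩ := Finset.mem_filter.1 hx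
    have hdl : d ≤ zx.1.length := hl ▸ hd
    have hcz : List.IsChain (· ≠ ·) zx.1 := hc.left_of_append
    rw [List.rotate_eq_drop_append_take hdl] at hx2
    rw [Finset.mem_coe, Finset.mem_filter, Finset.mem_product, Finset.mem_product, Finset.mem_filter,
      Finset.mem_filter, mem_words, mem_words]
    refine ⟨⟨Finset.mem_univ _, ⟨?_, hcz.take d⟩, ?_, hcz.drop d⟩, ?_, hx2⟩
    · rw [List.length_take]; omega
    · rw [List.length_drop, hl]
    · dsimp only
      rw [List.take_append_drop]; exact hx1
  · intro zx hzx zx' hzx' h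
    simp only [Prod.mk.injEq] at h
    obtain ⟨h1, h2, h3⟩ := h
    have e1 : zx.1 = zx'.1 := by
      rw [← List.take_append_drop d zx.1, ← List.take_append_drop d zx'.1, h2, h3]
    exact Sigma.ext e1 (heq_of_eq h1)

/-- **Registered form** (`stub_slidesRotation`, a `--supports` helper for the open core `stub_poorRigidCore` of crux
`stmt-MatrixMultiplication-10883`): `rotPair_reindex` and `rotSlides_le_slides`, fully quantified. -/
theorem stub_slidesRotation : ∀ (n m d : ℕ) (μ : Fin 3 → Equiv.Perm (Fin n)), d ≤ m → (∀ s ≤ m, ∑ z ∈ ((Finset.univ : Finset (List.Vector (Fin 3) m)).image (fun v => v.toList)).filter (fun z => List.IsChain (· ≠ ·) (z ++ z)), ((Finset.univ : Finset (Fin n)).filter (fun x => (z.rotate s).foldl (fun v c => μ c v) x = x ∧ (z.rotate (s + d)).foldl (fun v c => μ c v) x = x)).card = ∑ z ∈ ((Finset.univ : Finset (List.Vector (Fin 3) m)).image (fun v => v.toList)).filter (fun z => List.IsChain (· ≠ ·) (z ++ z)), ((Finset.univ : Finset (Fin n)).filter (fun x => z.foldl (fun v c => μ c v) x = x ∧ (z.rotate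 d).foldl (fun v c => μ c v) x = x)).card) ∧ ∑ z ∈ ((Finset.univ : Finset (List.Vector (Fin 3) m)).image (fun v => v.toList)).filter (fun z => List.IsChain (· ≠ ·) (z ++ z)), ((Finset.univ : Finset (Fin n)).filter (fun x => z.foldl (fun v c => μ c v) x = x ∧ (z.rotate d).foldl (fun v c => μ c v) x = x)).card ≤ (((Finset.univ : Finset (Fin n)) ×ˢ ((((Finset.univ : Finset (List.Vector (Fin 3) d)).image (fun v => v.toList)).filter (fun g => List.IsChain (· ≠ ·) g)) ×ˢ (((Finset.univ : Finset (List.Vector (Fin 3) (m - d))).image (fun v => v.toList)).filter (fun g => List.IsChain (· ≠ ·) g)))).filter (fun q => (q.2.1 ++ q.2.2).foldl (fun v b => μ b v) q.1 = q.1 ∧ (q.2.2 ++ q.2.1).foldl (fun v b => μ b v) q.1 = q.1)).card :=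
  fun _ _ d μ hd => ⟨fun _ hs => rotPair_reindex μ hs d, rotSlides_le_slides μ hd⟩

end Summit.MatrixMultiplication.MatrixMultiplication.Theorems.HyperoctahedralThreshold.SlidesRotation
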